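import Literature.Barriers.NavierStokesRegularity.CriticalDataSmoothNonuniquenessProofs
import Literature.Analysis.FluidPDE.PeriodicBoundedMildTorus
import Literature.Analysis.FluidPDE.KNSSMildRegularityTime
import Literature.Analysis.FunctionSpaces.TorusClassicalNSRestart
import Literature.Analysis.FunctionSpaces.TorusClassicalNSUniqueness
import HarnessLib

/-!
# Coiculescu–Palasek 2025, §5 (last paragraph): the small-data global extension on `𝕋³`, proved

Sibling proof file of `CriticalDataSmoothNonuniquenessProofs` **discharging the named fact
`Literature.Barriers.NavierStokesRegularity.CoiculescuPalasek2025_globalExtension`**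
(M. P. Coiculescu, S. Palasek, *Non-uniqueness of smooth solutions of the Navier–Stokes
equations from critical data*, Invent. Math. 244 (2025), 165–219 = arXiv:2503.14699, §5, last
paragraph, with Rmk. 1.3: "Finally, let us extend our solutions on `[0,1]` to be global
solutions. … `v⁽ⁱ⁾|_{t=1}` can be made arbitrarily small …, and existence of a global-in-time
solution follows"; the global solutions obey `sup_{t>0} t^{1/2}‖u(t)‖_∞ < ∞`). The fact, as
vendored: there is `ε > 0` such that every classical solution of the unforced Navier–Stokes
equations on `(0, T] × 𝕋³` whose value at `T` has zero mean and sup norm `≤ ε` extends to a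
classical solution on `(0, ∞) × 𝕋³` agreeing with it on `(0, T]` and obeying `√t ‖U(t)‖_∞ ≤ C`
for `t ≥ T`.

## The proof (restart and decay; Robinson–Rodrigo–Sadowski 2016, §8.1; the `L^∞` local theory
of Koch–Nadirashvili–Seregin–Šverák 2009 / Giga–Inui–Matsui 1999 on the torus)

All ingredients are proved in the tree:

* the **local theory on the torus with existence time `ε₀/M²` for data of sup norm `≤ M`**,
  sup bound `C₀M`, Duhamel deviation `‖V(t) − e^{(t−s)Δ}a‖_∞ ≤ K√(t−s)(C₀M)²`
  (`Torus.exists_classicalNS_of_bounded_data`, `PeriodicBoundedMildTorus.lean`);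
* **uniqueness** of classical solutions on the torus issuing from the same datum, in the form
  "classical for `t > s` and `L²`-continuous at `s`" versus "classical on `[s, b]`"
  (`Torus.IsClassicalNSSolutionOn.velocity_unique_Ioc_of_tendsto`, `TorusClassicalNSUniqueness.lean`),
  fed by the deviation bound and `‖e^{τΔ}ã − ã‖_∞ ≤ C_a τ` (`norm_heatExtension_sub_self_le`);
* **gluing / locality in time** (`Torus.IsClassicalNSSolutionOn.glue_Ioo`, `….of_local`) and
  conservation of the mean (`….hasZeroMean_of_hasZeroMean`);
* the **decay mechanism**: for mean-zero data the free evolution contracts in sup norm,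
  `‖e^{τΔ}a‖_∞ ≤ η(τ)‖a‖_∞` with `η(τ) = ∑_{k≠0} e^{-4π²|k|²τ} → 0`
  (`Torus.norm_heatSmoothing_le_of_hasZeroMean`, `Torus.exists_tsum_heatCoeff_sub_one_le`).

**Scheme.** Fix `τ⋆ ≥ 1` with `η(τ⋆) ≤ 1/4` and let `M₀` be so small that `(τ⋆+1)M₀² ≤ ε₀` (every
window from data of size `≤ M₀` is longer than `τ⋆ + 1`) and `K√τ⋆ C₀² M₀ ≤ 1/4`; the threshold
is `ε = M₀/2`. Given the solution `u` on `(0, T]` with `‖u(T)‖_∞ ≤ ε`, pick `T' ∈ (T−1, T)` with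
`‖u(T')‖_∞ ≤ M₀` (continuity), solve from `u(T')` at time `T'`, identify with `u` on `(T', T]`
(uniqueness; `u` is smooth on `[T', T]`) and glue: a classical solution on `(0, T' + ε₀/M₀²)`
extending `u` (`restart_stage_zero`). Then restart at the times `s_k = T' + kτ⋆` from the data
`U(s_k)`, whose sup norms halve: `‖U(s_{k+1})‖_∞ ≤ η(τ⋆)M_k + K√τ⋆(C₀M_k)² ≤ M_k/2` (`restart_step`:
local solution from `U(s_{k+1})`, identification on `(s_{k+1}, s_{k+1} + 1/2]`, gluing at
`s_{k+1} + 1/2`, with pressures normalised at a base point so that consecutive stages agree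
before the gluing time). The stages are consistent, so they define one pair `(U, P)` on
`(0, ∞)`, classical by locality; on `[s_k, s_{k+1}]` one has `‖U‖_∞ ≤ C₀M₀2^{-k}` while
`√t ≤ √(T'+τ⋆)·2^k`, whence `√t‖U(t)‖_∞ ≤ √(T'+τ⋆) C₀M₀` for `t ≥ T`.

## References

* M. P. Coiculescu, S. Palasek, Invent. Math. 244 (2025) = arXiv:2503.14699, §5 (last paragraph),
  Thm. 1.1, Rmk. 1.3. [CoiculescuPalasek2025]
* J. C. Robinson, J. L. Rodrigo, W. Sadowski, *The Three-Dimensional Navier–Stokes Equations.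
  Classical Theory*, CUP 2016, §8.1 (restart and identification), §11.2 Thm. 11.4 (ii)
  (small data). [RobinsonRodrigoSadowskiCUP2016]
* G. Koch, N. Nadirashvili, G. Seregin, V. Šverák, Acta Math. 203 (2009) = arXiv:0709.3599, §4.
  [KochNadirashviliSereginSverak2009]
* Y. Giga, K. Inui, S. Matsui, Quaderni di Matematica 4 (1999) 27–68 (nondecaying data).
-/

noncomputable section

open MeasureTheory Set Filter Function
open Literature.Analysis.FunctionSpaces Literature.Analysis.FluidPDE Literature.Analysis.UnboundedOperators
open _root_.Topology
open scoped InnerProductSpace RealInnerProductSpace Laplacian ContDiff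

namespace Literature.Barriers.NavierStokesRegularity

/-! ## The free evolution of smooth periodic data approaches the data uniformly -/

/-- **`‖e^{τΔ}ã(repr x) − a(x)‖ ≤ C_a τ`** for a smooth field `a` on `𝕋ᵈ` (`ã = lift a`): the
caloric increment of `C²`-bounded data is at most `‖Δã‖_∞ τ` (`norm_heatExtension_sub_self_le`),
and the lift of a smooth torus field is bounded with all its derivatives. [folklore] -/
theorem Torus.exists_norm_heatExtension_lift_sub_le {d : Type*} [Fintype d]
    {F : Type*} [NormedAddCommGroup F] [InnerProductSpace ℝ F] [CompleteSpace F]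
    {a : UnitAddTorus d → F} (ha : Torus.IsSmooth a) :
    ∃ C : ℝ, 0 ≤ C ∧ ∀ τ : ℝ, 0 < τ → ∀ x,
      ‖heatExtension (Torus.lift a) τ (Torus.repr x) - a x‖ ≤ C * τ := by
  obtain ⟨B₀, -, hB₀⟩ := TorusHeat.exists_norm_lift_le ha.continuous
  obtain ⟨B₁, -, hB₁⟩ := TorusHeat.exists_norm_fderiv_lift_le ha
  obtain ⟨B₂, -, hB₂⟩ := TorusHeat.exists_norm_fderiv_fderiv_lift_le ha
  obtain ⟨BΔ, hBΔ0, hBΔ⟩ := TorusHeat.exists_norm_lift_le ha.laplacian.continuous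
  refine ⟨BΔ, hBΔ0, fun τ hτ x => ?_⟩
  have hΔ : ∀ z, ‖(Δ (Torus.lift a)) z‖ ≤ BΔ := fun z => by
    have h1 := hBΔ z
    rwa [Torus.lift_apply, ← Torus.laplacian_lift] at h1
  have h2 : ContDiff ℝ 2 (Torus.lift a) := (ha : ContDiff ℝ ∞ (Torus.lift a)).of_le (by norm_cast)
  have h := KNSSBootstrap.norm_heatExtension_sub_self_le h2 hB₀ hB₁ hB₂ hΔ hτ (Torus.repr x)
  rwa [Torus.lift_repr] at h

/-! ## The restart scheme -/

section Restart

variable {ε₀ C₀ K τs : ℝ}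

/-- **One restart with halving of the sup norm** (the step `k → k+1` of the scheme in the module
docstring). Constants: `ε₀, C₀, K` of the local theory `hT1` (the statement of
`Torus.exists_classicalNS_of_bounded_data`), a contraction time `τ⋆ ≥ 1` with
`∑_{k≠0}e^{-4π²|k|²τ⋆} ≤ 1/4`, and the smallness `(τ⋆+1)M² ≤ ε₀`, `K√τ⋆C₀²M ≤ 1/4`. Input: a
classical solution `(U, P)` on `(0, s + ε₀/M²)` extending `u` on `(0, T]` (`T < s + τ⋆`), with
`‖U(s)‖_∞ ≤ M`, the Duhamel deviation bound from the datum `U(s)` on the window, mean-zero slices,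
and pressure vanishing at the base point `x₀`. Output: the same on `(0, s' + ε₀/(M/2)²)`,
`s' = s + τ⋆`, with the halved size `M/2`, the sup bound `C₀M/2` on the new window, and agreement
with `(U, P)` before the gluing time `s' + 1/2`. Proof: the datum `U(s')` has sup norm
`≤ η(τ⋆)M + K√τ⋆(C₀M)² ≤ M/2` (decay of the free flow of the mean-zero `U(s)` plus the deviation);
solve from it (`hT1`), identify with `U` on `(s', s' + 1/2]` by uniqueness (the new solution
tends to `U(s')` uniformly: deviation bound and `Torus.exists_norm_heatExtension_lift_sub_le`),
glue at `s' + 1/2` (`glue_Ioo`), and propagate the zero mean from time `s`.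
[cite: CoiculescuPalasek2025, §5 (last paragraph) with Rmk. 1.3] -/
theorem restart_step (hε₀ : 0 < ε₀) (hτs : 1 ≤ τs)
    (hT1 : ∀ ⦃M : ℝ⦄, 0 < M → ∀ (s : ℝ) ⦃a : UnitAddTorus (Fin 3) → EuclideanSpace ℝ (Fin 3)⦄,
        Torus.IsSmooth a → Torus.IsDivFree a → (∀ x, ‖a x‖ ≤ M) →
        ∃ (V : ℝ → UnitAddTorus (Fin 3) → EuclideanSpace ℝ (Fin 3))
          (Q : ℝ → UnitAddTorus (Fin 3) → ℝ),
          Torus.IsClassicalNSSolutionOn (Ioo s (s + ε₀ / M ^ 2)) 1 0 V Q ∧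
          (∀ t ∈ Ioo s (s + ε₀ / M ^ 2), ∀ x, ‖V t x‖ ≤ C₀ * M) ∧
          (∀ t ∈ Ioo s (s + ε₀ / M ^ 2), ∀ x,
            ‖V t x - heatExtension (Torus.lift a) (t - s) (Torus.repr x)‖ ≤
              K * Real.sqrt (t - s) * (C₀ * M) ^ 2) ∧
          (∀ t ∈ Ioo s (s + ε₀ / M ^ 2), ∫ x, V t x = ∫ x, a x))
    (hη : (∑' k : Fin 3 → ℤ, Torus.heatCoeff τs k) - 1 ≤ 1 / 4)
    {u : ℝ → UnitAddTorus (Fin 3) → EuclideanSpace ℝ (Fin 3)} {T : ℝ} (x₀ : UnitAddTorus (Fin 3))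
    {s M : ℝ} (hs : 0 < s) (hM : 0 < M) (hsT : T < s + τs)
    (hsmall₁ : (τs + 1) * M ^ 2 ≤ ε₀) (hsmall₂ : K * Real.sqrt τs * C₀ ^ 2 * M ≤ 1 / 4)
    {U : ℝ → UnitAddTorus (Fin 3) → EuclideanSpace ℝ (Fin 3)} {P : ℝ → UnitAddTorus (Fin 3) → ℝ}
    (hsol : Torus.IsClassicalNSSolutionOn (Ioo 0 (s + ε₀ / M ^ 2)) 1 0 U P)
    (hagree : ∀ t ∈ Ioc 0 T, U t = u t)
    (hdat : ∀ x, ‖U s x‖ ≤ M)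
    (hdev : ∀ t ∈ Ioo s (s + ε₀ / M ^ 2), ∀ x,
      ‖U t x - heatExtension (Torus.lift (U s)) (t - s) (Torus.repr x)‖ ≤
        K * Real.sqrt (t - s) * (C₀ * M) ^ 2)
    (hmz : ∀ t ∈ Ioo 0 (s + ε₀ / M ^ 2), Torus.HasZeroMean (U t))
    (hpz : ∀ t, P t x₀ = 0) :
    ∃ (U' : ℝ → UnitAddTorus (Fin 3) → EuclideanSpace ℝ (Fin 3)) (P' : ℝ → UnitAddTorus (Fin 3) → ℝ),
      Torus.IsClassicalNSSolutionOn (Ioo 0 ((s + τs) + ε₀ / (M / 2) ^ 2)) 1 0 U' P' ∧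
      (∀ t ∈ Ioc 0 T, U' t = u t) ∧
      (∀ x, ‖U' (s + τs) x‖ ≤ M / 2) ∧
      (∀ t ∈ Ioo (s + τs) ((s + τs) + ε₀ / (M / 2) ^ 2), ∀ x, ‖U' t x‖ ≤ C₀ * (M / 2)) ∧
      (∀ t ∈ Ioo (s + τs) ((s + τs) + ε₀ / (M / 2) ^ 2), ∀ x,
        ‖U' t x - heatExtension (Torus.lift (U' (s + τs))) (t - (s + τs)) (Torus.repr x)‖ ≤
          K * Real.sqrt (t - (s + τs)) * (C₀ * (M / 2)) ^ 2) ∧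
      (∀ t ∈ Ioo 0 ((s + τs) + ε₀ / (M / 2) ^ 2), Torus.HasZeroMean (U' t)) ∧
      (∀ t, P' t x₀ = 0) ∧
      (∀ t < s + τs + 1 / 2, U' t = U t) ∧ (∀ t < s + τs + 1 / 2, P' t = P t) := by
  set h : ℝ := ε₀ / M ^ 2 with hh
  set s' : ℝ := s + τs with hs'
  set M' : ℝ := M / 2 with hM'
  set h' : ℝ := ε₀ / M' ^ 2 with hh'
  have hM'pos : 0 < M' := by positivity
  have hwin : τs + 1 ≤ h := by
    rw [hh, le_div_iff₀ (by positivity)]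
    linarith
  have hh'eq : h' = 4 * h := by
    rw [hh', hh, hM']
    field_simp
    ring
  have hh0 : 0 ≤ h := by positivity
  have hwin' : τs + 1 ≤ h' := by rw [hh'eq]; linarith
  have hs'pos : 0 < s' := by rw [hs']; linarith
  have hs'win : s' ∈ Ioo s (s + h) := ⟨by rw [hs']; linarith, by rw [hs']; linarith⟩
  have hswin : s ∈ Ioo 0 (s + h) := ⟨hs, by linarith⟩
  have hUs_sm : Torus.IsSmooth (U s) := hsol.smooth_velocity.isSmooth_slice hswin
  have hUs'_sm : Torus.IsSmooth (U s') := hsol.smooth_velocity.isSmooth_slice ⟨hs'pos, hs'win.2⟩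
  have hUs'_div : Torus.IsDivFree (U s') := hsol.divFree _ ⟨hs'pos, hs'win.2⟩
  -- the new datum is half as large
  have hdat' : ∀ x, ‖U s' x‖ ≤ M' := by
    intro x
    have h1 := hdev s' hs'win x
    have hτ : s' - s = τs := by rw [hs']; ring
    rw [hτ] at h1
    have hheat : ‖heatExtension (Torus.lift (U s)) τs (Torus.repr x)‖ ≤
        ((∑' k : Fin 3 → ℤ, Torus.heatCoeff τs k) - 1) * M := by
      rw [heatExtension_apply]
      simp_rw [Literature.Analysis.FluidPDE.Torus.lift_repr_sub]
      exact Torus.norm_heatSmoothing_le_of_hasZeroMean hUs_sm (hmz s hswin) hdat (by linarith) x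
    calc ‖U s' x‖ = ‖(U s' x - heatExtension (Torus.lift (U s)) τs (Torus.repr x)) +
            heatExtension (Torus.lift (U s)) τs (Torus.repr x)‖ := by rw [sub_add_cancel]
      _ ≤ ‖U s' x - heatExtension (Torus.lift (U s)) τs (Torus.repr x)‖ +
            ‖heatExtension (Torus.lift (U s)) τs (Torus.repr x)‖ := norm_add_le _ _
      _ ≤ K * Real.sqrt τs * (C₀ * M) ^ 2 + ((∑' k : Fin 3 → ℤ, Torus.heatCoeff τs k) - 1) * M :=
            add_le_add h1 hheat
      _ ≤ 1 / 4 * M + 1 / 4 * M := by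
            have e1 : K * Real.sqrt τs * (C₀ * M) ^ 2 = (K * Real.sqrt τs * C₀ ^ 2 * M) * M := by
              ring
            rw [e1]
            exact add_le_add (mul_le_mul_of_nonneg_right hsmall₂ hM.le)
              (mul_le_mul_of_nonneg_right hη hM.le)
      _ = M' := by rw [hM']; ring
  -- the local solution from `U s'`
  obtain ⟨V, Q, hV, hVb, hVdev, -⟩ := hT1 hM'pos s' hUs'_sm hUs'_div hdat'
  -- identification on `(s', s' + 1/2]`
  have hhalf_h' : (1 : ℝ) / 2 < h' := by linarith
  have hIoc_sub : Ioc s' (s' + 1 / 2) ⊆ Ioo s' (s' + ε₀ / M' ^ 2) := fun t ht =>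
    ⟨ht.1, ht.2.trans_lt (by rw [← hh']; linarith)⟩
  have hIcc_sub : Icc s' (s' + 1 / 2) ⊆ Ioo 0 (s + h) := fun t ht =>
    ⟨hs'pos.trans_le ht.1, by rw [hs'] at ht; linarith [ht.2]⟩
  have h₁ := hV.mono hIoc_sub (uniqueDiffOn_Ioc _ _)
  have h₂ := hsol.mono hIcc_sub (uniqueDiffOn_Icc (by linarith))
  obtain ⟨Ca, -, hCa⟩ := Torus.exists_norm_heatExtension_lift_sub_le hUs'_sm
  have happroach : ∀ ε > 0, ∀ᶠ t in 𝓝[>] s', ∀ x, ‖V t x - U s' x‖ ≤ ε := by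
    intro ε hε
    have hg : Tendsto (fun t : ℝ => K * Real.sqrt (t - s') * (C₀ * M') ^ 2 + Ca * (t - s'))
        (𝓝[>] s') (𝓝 0) := by
      have hc : Continuous fun t : ℝ => K * Real.sqrt (t - s') * (C₀ * M') ^ 2 + Ca * (t - s') :=
        ((continuous_const.mul (Real.continuous_sqrt.comp (continuous_id.sub continuous_const))).mul
          continuous_const).add (continuous_const.mul (continuous_id.sub continuous_const))
      have h0 := hc.tendsto s'
      simp only [sub_self, Real.sqrt_zero, mul_zero, zero_mul, add_zero] at h0
      exact h0.mono_left nhdsWithin_le_nhds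
    filter_upwards [hg.eventually (ge_mem_nhds hε),
      Ioo_mem_nhdsGT (show s' < s' + ε₀ / M' ^ 2 by rw [← hh']; linarith)] with t hgt ht x
    calc ‖V t x - U s' x‖
        ≤ ‖V t x - heatExtension (Torus.lift (U s')) (t - s') (Torus.repr x)‖ +
            ‖heatExtension (Torus.lift (U s')) (t - s') (Torus.repr x) - U s' x‖ :=
          norm_sub_le_norm_sub_add_norm_sub _ _ _
      _ ≤ K * Real.sqrt (t - s') * (C₀ * M') ^ 2 + Ca * (t - s') :=
          add_le_add (hVdev t ht x) (hCa (t - s') (sub_pos.2 ht.1) x)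
      _ ≤ ε := hgt
  have h0 : Tendsto (fun t => ∫ x, ‖V t x - U t x‖ ^ 2) (𝓝[>] s') (𝓝 0) :=
    Torus.tendsto_integral_norm_sub_sq_of_uniform h₂.smooth_velocity (by linarith) happroach
  have huniq : ∀ t ∈ Ioc s' (s' + 1 / 2), V t = U t := fun t ht =>
    Torus.IsClassicalNSSolutionOn.velocity_unique_Ioc_of_tendsto zero_le_one h₁ h₂ h0 ht
  -- gluing at `s' + 1/2`
  have hglue := Torus.IsClassicalNSSolutionOn.glue_Ioo
    (hsol.mono (Ioo_subset_Ioo_right (show s' + 1 / 2 ≤ s + h by rw [hs']; linarith))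
      isOpen_Ioo.uniqueDiffOn)
    hV hs'pos.le (by linarith : s' < s' + 1 / 2)
    (show s' + 1 / 2 ≤ s' + ε₀ / M' ^ 2 by rw [← hh']; linarith)
    (fun t ht => (huniq t ⟨ht.1, ht.2.le⟩).symm) x₀
  set W : ℝ → UnitAddTorus (Fin 3) → EuclideanSpace ℝ (Fin 3) :=
    fun t => if t < s' + 1 / 2 then U t else V t with hW
  set PW : ℝ → UnitAddTorus (Fin 3) → ℝ :=
    fun t => if t < s' + 1 / 2 then (fun x => P t x - P t x₀) else fun x => Q t x - Q t x₀ with hPW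
  have hWU : ∀ t < s' + 1 / 2, W t = U t := fun t ht => if_pos ht
  have hWV : ∀ t ∈ Ioo s' (s' + ε₀ / M' ^ 2), W t = V t := by
    intro t ht
    by_cases htT : t < s' + 1 / 2
    · rw [hWU t htT]
      exact (huniq t ⟨ht.1, htT.le⟩).symm
    · exact if_neg htT
  have hsdom : s ∈ Ioo 0 (s' + ε₀ / M' ^ 2) := ⟨hs, by rw [← hh', hs']; linarith⟩
  refine ⟨W, PW, hglue, fun t ht => ?_, fun x => ?_, fun t ht x => ?_, fun t ht x => ?_,
    fun t ht => ?_, fun t => ?_, hWU, fun t ht => ?_⟩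
  · rw [hWU t (by rw [hs']; linarith [ht.2])]
    exact hagree t ht
  · rw [hWU s' (by linarith)]
    exact hdat' x
  · rw [hWV t ht]
    exact hVb t ht x
  · rw [hWV t ht, hWU s' (by linarith)]
    exact hVdev t ht x
  · have hms : Torus.HasZeroMean (W s) := by
      rw [hWU s (by rw [hs']; linarith)]
      exact hmz s hswin
    exact hglue.hasZeroMean_of_hasZeroMean (convex_Ioo _ _) hsdom ht hms
  · show (if t < s' + 1 / 2 then (fun x => P t x - P t x₀) else fun x => Q t x - Q t x₀) x₀ = 0
    by_cases ht : t < s' + 1 / 2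
    · rw [if_pos ht]
      exact sub_self _
    · rw [if_neg ht]
      exact sub_self _
  · show (if t < s' + 1 / 2 then (fun x => P t x - P t x₀) else fun x => Q t x - Q t x₀) = P t
    rw [if_pos ht]
    funext x
    rw [hpz t, sub_zero]

/-- **The first restart, from the given solution on `(0, T]`.** With the constants as in
`restart_step` and `(τ⋆+1)M₀² ≤ ε₀`: a classical solution `u` on `(0, T] × 𝕋³` with `u(T)` of zero
mean and `‖u(T)‖_∞ ≤ M₀/2` extends to a classical solution on `(0, T' + ε₀/M₀²)` for some
`T' ∈ (T − 1, T) ∩ (0, T)` with `‖u(T')‖_∞ ≤ M₀` (continuity at `T`), equal to `u` on `(0, T]`: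
solve from `u(T')` at time `T'`, identify with `u` on `(T', T]` (`u` is classical on `[T', T]`,
the new solution tends to `u(T')` uniformly), and glue at `T` (the pressure of `u` normalised at
`x₀`). [cite: CoiculescuPalasek2025, §5 (last paragraph)] -/
theorem restart_stage_zero (hτs : 1 ≤ τs)
    (hT1 : ∀ ⦃M : ℝ⦄, 0 < M → ∀ (s : ℝ) ⦃a : UnitAddTorus (Fin 3) → EuclideanSpace ℝ (Fin 3)⦄,
        Torus.IsSmooth a → Torus.IsDivFree a → (∀ x, ‖a x‖ ≤ M) →
        ∃ (V : ℝ → UnitAddTorus (Fin 3) → EuclideanSpace ℝ (Fin 3))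
          (Q : ℝ → UnitAddTorus (Fin 3) → ℝ),
          Torus.IsClassicalNSSolutionOn (Ioo s (s + ε₀ / M ^ 2)) 1 0 V Q ∧
          (∀ t ∈ Ioo s (s + ε₀ / M ^ 2), ∀ x, ‖V t x‖ ≤ C₀ * M) ∧
          (∀ t ∈ Ioo s (s + ε₀ / M ^ 2), ∀ x,
            ‖V t x - heatExtension (Torus.lift a) (t - s) (Torus.repr x)‖ ≤
              K * Real.sqrt (t - s) * (C₀ * M) ^ 2) ∧
          (∀ t ∈ Ioo s (s + ε₀ / M ^ 2), ∫ x, V t x = ∫ x, a x))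
    {T : ℝ} (hT : 0 < T) {u : ℝ → UnitAddTorus (Fin 3) → EuclideanSpace ℝ (Fin 3)}
    {p : ℝ → UnitAddTorus (Fin 3) → ℝ} (hu : Torus.IsClassicalNSSolutionOn (Ioc 0 T) 1 0 u p)
    (hmean : Torus.HasZeroMean (u T)) {M₀ : ℝ} (hM₀ : 0 < M₀) (hsmall₁ : (τs + 1) * M₀ ^ 2 ≤ ε₀)
    (hε : ∀ x, ‖u T x‖ ≤ M₀ / 2) (x₀ : UnitAddTorus (Fin 3)) :
    ∃ T' : ℝ, 0 < T' ∧ T' < T ∧ T < T' + 1 ∧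
      ∃ (U : ℝ → UnitAddTorus (Fin 3) → EuclideanSpace ℝ (Fin 3)) (P : ℝ → UnitAddTorus (Fin 3) → ℝ),
        Torus.IsClassicalNSSolutionOn (Ioo 0 (T' + ε₀ / M₀ ^ 2)) 1 0 U P ∧
        (∀ t ∈ Ioc 0 T, U t = u t) ∧
        (∀ x, ‖U T' x‖ ≤ M₀) ∧
        (∀ t ∈ Ioo T' (T' + ε₀ / M₀ ^ 2), ∀ x, ‖U t x‖ ≤ C₀ * M₀) ∧
        (∀ t ∈ Ioo T' (T' + ε₀ / M₀ ^ 2), ∀ x,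
          ‖U t x - heatExtension (Torus.lift (U T')) (t - T') (Torus.repr x)‖ ≤
            K * Real.sqrt (t - T') * (C₀ * M₀) ^ 2) ∧
        (∀ t ∈ Ioo 0 (T' + ε₀ / M₀ ^ 2), Torus.HasZeroMean (U t)) ∧
        (∀ t, P t x₀ = 0) := by
  set h : ℝ := ε₀ / M₀ ^ 2 with hh
  have hwin : τs + 1 ≤ h := by
    rw [hh, le_div_iff₀ (by positivity)]
    linarith
  -- a restart time `T'` close to `T` with `‖u(T')‖ ≤ M₀`
  obtain ⟨T', ⟨hT'1, hT'T⟩, hT'small⟩ : ∃ T', T' ∈ Ioo (max (T - 1) (T / 2)) T ∧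
      ∀ x, ‖u T' x - u T x‖ < M₀ / 2 := by
    have h1 : ∀ᶠ t in 𝓝[<] T, ∀ x, ‖u t x - u T x‖ < M₀ / 2 := by
      have h2 := hu.smooth_velocity.eventually_norm_sub_lt (right_mem_Ioc.2 hT) (half_pos hM₀)
      rw [← nhdsWithin_Ioo_eq_nhdsLT hT]
      exact h2.filter_mono (nhdsWithin_mono T Ioo_subset_Ioc_self)
    have h3 : ∀ᶠ t in 𝓝[<] T, t ∈ Ioo (max (T - 1) (T / 2)) T :=
      Ioo_mem_nhdsLT (max_lt (by linarith) (by linarith))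
    exact (h3.and h1).exists
  have hT'0 : 0 < T' := by
    have := le_max_right (T - 1) (T / 2)
    linarith
  have hTT' : T < T' + 1 := by
    have := le_max_left (T - 1) (T / 2)
    linarith
  have hT'mem : T' ∈ Ioc 0 T := ⟨hT'0, hT'T.le⟩
  have hdat : ∀ x, ‖u T' x‖ ≤ M₀ := fun x => by
    have h1 := hT'small x
    have h2 := hε x
    calc ‖u T' x‖ = ‖(u T' x - u T x) + u T x‖ := by rw [sub_add_cancel]
      _ ≤ ‖u T' x - u T x‖ + ‖u T x‖ := norm_add_le _ _
      _ ≤ M₀ := by linarith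
  have ha_sm : Torus.IsSmooth (u T') := hu.smooth_velocity.isSmooth_slice hT'mem
  have ha_div : Torus.IsDivFree (u T') := hu.divFree _ hT'mem
  -- the local solution from `u T'`
  obtain ⟨V, Q, hV, hVb, hVdev, -⟩ := hT1 hM₀ T' ha_sm ha_div hdat
  -- identification on `(T', T]`
  have hIoc_sub : Ioc T' T ⊆ Ioo T' (T' + ε₀ / M₀ ^ 2) := fun t ht =>
    ⟨ht.1, ht.2.trans_lt (by rw [← hh]; linarith)⟩
  have hIcc_sub : Icc T' T ⊆ Ioc 0 T := fun t ht => ⟨hT'0.trans_le ht.1, ht.2⟩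
  have h₁ := hV.mono hIoc_sub (uniqueDiffOn_Ioc _ _)
  have h₂ := hu.mono hIcc_sub (uniqueDiffOn_Icc hT'T)
  obtain ⟨Ca, -, hCa⟩ := Torus.exists_norm_heatExtension_lift_sub_le ha_sm
  have happroach : ∀ ε > 0, ∀ᶠ t in 𝓝[>] T', ∀ x, ‖V t x - u T' x‖ ≤ ε := by
    intro ε hε'
    have hg : Tendsto (fun t : ℝ => K * Real.sqrt (t - T') * (C₀ * M₀) ^ 2 + Ca * (t - T'))
        (𝓝[>] T') (𝓝 0) := by
      have hc : Continuous fun t : ℝ => K * Real.sqrt (t - T') * (C₀ * M₀) ^ 2 + Ca * (t - T') :=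
        ((continuous_const.mul (Real.continuous_sqrt.comp (continuous_id.sub continuous_const))).mul
          continuous_const).add (continuous_const.mul (continuous_id.sub continuous_const))
      have h0 := hc.tendsto T'
      simp only [sub_self, Real.sqrt_zero, mul_zero, zero_mul, add_zero] at h0
      exact h0.mono_left nhdsWithin_le_nhds
    filter_upwards [hg.eventually (ge_mem_nhds hε'),
      Ioo_mem_nhdsGT (show T' < T' + ε₀ / M₀ ^ 2 by rw [← hh]; linarith)] with t hgt ht x
    calc ‖V t x - u T' x‖
        ≤ ‖V t x - heatExtension (Torus.lift (u T')) (t - T') (Torus.repr x)‖ +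
            ‖heatExtension (Torus.lift (u T')) (t - T') (Torus.repr x) - u T' x‖ :=
          norm_sub_le_norm_sub_add_norm_sub _ _ _
      _ ≤ K * Real.sqrt (t - T') * (C₀ * M₀) ^ 2 + Ca * (t - T') :=
          add_le_add (hVdev t ht x) (hCa (t - T') (sub_pos.2 ht.1) x)
      _ ≤ ε := hgt
  have h0 : Tendsto (fun t => ∫ x, ‖V t x - u t x‖ ^ 2) (𝓝[>] T') (𝓝 0) :=
    Torus.tendsto_integral_norm_sub_sq_of_uniform h₂.smooth_velocity hT'T happroach
  have huniq : ∀ t ∈ Ioc T' T, V t = u t := fun t ht =>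
    Torus.IsClassicalNSSolutionOn.velocity_unique_Ioc_of_tendsto zero_le_one h₁ h₂ h0 ht
  -- gluing at `T`
  have hu' := (hu.sub_pressure_apply x₀).mono Ioo_subset_Ioc_self isOpen_Ioo.uniqueDiffOn
  have hglue := Torus.IsClassicalNSSolutionOn.glue_Ioo hu' hV hT'0.le hT'T
    (show T ≤ T' + ε₀ / M₀ ^ 2 by rw [← hh]; linarith)
    (fun t ht => (huniq t ⟨ht.1, ht.2.le⟩).symm) x₀
  set W : ℝ → UnitAddTorus (Fin 3) → EuclideanSpace ℝ (Fin 3) :=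
    fun t => if t < T then u t else V t with hW
  have hWu : ∀ t < T, W t = u t := fun t ht => if_pos ht
  have hWV : ∀ t ∈ Ioo T' (T' + ε₀ / M₀ ^ 2), W t = V t := by
    intro t ht
    by_cases htT : t < T
    · rw [hWu t htT]
      exact (huniq t ⟨ht.1, htT.le⟩).symm
    · exact if_neg htT
  have hWagree : ∀ t ∈ Ioc 0 T, W t = u t := by
    intro t ht
    rcases ht.2.lt_or_eq with hlt | heq
    · exact hWu t hlt
    · rw [heq, show W T = V T from if_neg (lt_irrefl T)]
      exact huniq T ⟨hT'T, le_rfl⟩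
  have hTdom : T ∈ Ioo 0 (T' + ε₀ / M₀ ^ 2) := ⟨hT, by rw [← hh]; linarith⟩
  refine ⟨T', hT'0, hT'T, hTT', W, _, hglue, hWagree, fun x => ?_, fun t ht x => ?_,
    fun t ht x => ?_, fun t ht => ?_, fun t => ?_⟩
  · rw [hWu T' hT'T]
    exact hdat x
  · rw [hWV t ht]
    exact hVb t ht x
  · rw [hWV t ht, hWu T' hT'T]
    exact hVdev t ht x
  · have hmT : Torus.HasZeroMean (W T) := by
      rw [hWagree T (right_mem_Ioc.2 hT)]
      exact hmean
    exact hglue.hasZeroMean_of_hasZeroMean (convex_Ioo _ _) hTdom ht hmT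
  · by_cases ht : t < T
    · rw [if_pos ht]
      exact sub_self _
    · rw [if_neg ht]
      exact sub_self _

end Restart

/-! ## The discharge -/

/-- **Coiculescu–Palasek 2025, §5 (last paragraph) with Rmk. 1.3: the small-data global
extension on `𝕋³`, proved** (the named fact `CoiculescuPalasek2025_globalExtension`). See the
module docstring for the scheme: with `ε₀, C₀, K` from `Torus.exists_classicalNS_of_bounded_data`
and a contraction time `τ⋆` of the free flow of mean-zero data, the threshold is `ε = M₀/2`,
`M₀ = min(√(ε₀/(τ⋆+1)), 1/(4(K√τ⋆C₀²+1)))`; the given solution is extended past `T` by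
`restart_stage_zero` and then indefinitely by `restart_step` at the times `T' + kτ⋆` with sizes
`M₀2^{-k}`; the stages agree before each gluing time, hence define a single classical solution on
`(0, ∞)` (`Torus.IsClassicalNSSolutionOn.of_local`), and `√t ‖U(t)‖_∞ ≤ √(T'+τ⋆) C₀ M₀` for
`t ≥ T`. [cite: CoiculescuPalasek2025, §5 (last paragraph) with Thm. 1.1 and Rmk. 1.3] -/
theorem CoiculescuPalasek2025_globalExtension_holds : CoiculescuPalasek2025_globalExtension := by
  obtain ⟨ε₀, hε₀, C₀, hC₀, K, hK, hT1⟩ := Torus.exists_classicalNS_of_bounded_data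
  obtain ⟨τs, hτs, hη⟩ :=
    Torus.exists_tsum_heatCoeff_sub_one_le (d := Fin 3) (show (0 : ℝ) < 1 / 4 by norm_num)
  -- the smallness scale
  set A : ℝ := K * Real.sqrt τs * C₀ ^ 2 with hA
  have hA0 : 0 ≤ A := by positivity
  set M₀ : ℝ := min (Real.sqrt (ε₀ / (τs + 1))) (1 / (4 * (A + 1))) with hM₀
  have hM₀pos : 0 < M₀ := lt_min (Real.sqrt_pos.2 (by positivity)) (by positivity)
  have hsmall₁ : ∀ M : ℝ, 0 ≤ M → M ≤ M₀ → (τs + 1) * M ^ 2 ≤ ε₀ := by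
    intro M hM0 hM
    have h1 : M ≤ Real.sqrt (ε₀ / (τs + 1)) := hM.trans (min_le_left _ _)
    have h2 : M ^ 2 ≤ ε₀ / (τs + 1) := by
      calc M ^ 2 ≤ Real.sqrt (ε₀ / (τs + 1)) ^ 2 := pow_le_pow_left₀ hM0 h1 2
        _ = ε₀ / (τs + 1) := Real.sq_sqrt (by positivity)
    rw [le_div_iff₀ (by positivity)] at h2
    linarith
  have hsmall₂ : ∀ M : ℝ, 0 ≤ M → M ≤ M₀ → K * Real.sqrt τs * C₀ ^ 2 * M ≤ 1 / 4 := by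
    intro M hM0 hM
    have h1 : M ≤ 1 / (4 * (A + 1)) := hM.trans (min_le_right _ _)
    rw [← hA]
    calc A * M ≤ A * (1 / (4 * (A + 1))) := mul_le_mul_of_nonneg_left h1 hA0
      _ ≤ 1 / 4 := by
          rw [mul_one_div, div_le_iff₀ (by positivity)]
          nlinarith
  refine ⟨M₀ / 2, by positivity, fun T hT u p hu hmean hε => ?_⟩
  set x₀ : UnitAddTorus (Fin 3) := 0 with hx₀
  -- stage zero
  obtain ⟨T', hT'0, hT'T, hTT', U0, P0, hst0⟩ :=
    restart_stage_zero (C₀ := C₀) (K := K) hτs hT1 hT hu hmean hM₀pos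
      (hsmall₁ M₀ hM₀pos.le le_rfl) hε x₀
  -- the invariant of the scheme at stage `k`: restart time `T' + kτ⋆`, size `M₀/2^k`
  set sk : ℕ → ℝ := fun k => T' + k * τs with hsk
  set Mk : ℕ → ℝ := fun k => M₀ / 2 ^ k with hMk
  have hsk0 : ∀ k, 0 < sk k := fun k => by
    have : (0 : ℝ) ≤ k * τs := by positivity
    simp only [hsk]; linarith
  have hsk_succ : ∀ k, sk k + τs = sk (k + 1) := fun k => by simp only [hsk]; push_cast; ring
  have hsk_mono : ∀ {k m : ℕ}, k ≤ m → sk k ≤ sk m := fun {k m} hkm => by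
    simp only [hsk]
    have : (k : ℝ) ≤ m := by exact_mod_cast hkm
    nlinarith
  have hMk_pos : ∀ k, 0 < Mk k := fun k => by simp only [hMk]; positivity
  have hMk_le : ∀ k, Mk k ≤ M₀ := fun k => by
    simp only [hMk]
    exact div_le_self hM₀pos.le (one_le_pow₀ (by norm_num))
  have hMk_succ : ∀ k, Mk k / 2 = Mk (k + 1) := fun k => by
    simp only [hMk]; rw [pow_succ]; ring
  have hwin : ∀ k, τs + 1 ≤ ε₀ / Mk k ^ 2 := fun k => by
    rw [le_div_iff₀ (by positivity)]
    linarith [hsmall₁ (Mk k) (hMk_pos k).le (hMk_le k)]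
  have hTsk : ∀ k, T < sk k + τs := fun k => by
    have := hsk_mono (Nat.zero_le k)
    simp only [hsk, Nat.cast_zero, zero_mul, add_zero] at this ⊢
    linarith
  set Inv : ℕ → (ℝ → UnitAddTorus (Fin 3) → EuclideanSpace ℝ (Fin 3)) →
      (ℝ → UnitAddTorus (Fin 3) → ℝ) → Prop := fun k U P =>
    Torus.IsClassicalNSSolutionOn (Ioo 0 (sk k + ε₀ / Mk k ^ 2)) 1 0 U P ∧
      (∀ t ∈ Ioc 0 T, U t = u t) ∧ (∀ x, ‖U (sk k) x‖ ≤ Mk k) ∧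
      (∀ t ∈ Ioo (sk k) (sk k + ε₀ / Mk k ^ 2), ∀ x, ‖U t x‖ ≤ C₀ * Mk k) ∧
      (∀ t ∈ Ioo (sk k) (sk k + ε₀ / Mk k ^ 2), ∀ x,
        ‖U t x - heatExtension (Torus.lift (U (sk k))) (t - sk k) (Torus.repr x)‖ ≤
          K * Real.sqrt (t - sk k) * (C₀ * Mk k) ^ 2) ∧
      (∀ t ∈ Ioo 0 (sk k + ε₀ / Mk k ^ 2), Torus.HasZeroMean (U t)) ∧ (∀ t, P t x₀ = 0)
    with hInv
  have hInv0 : Inv 0 U0 P0 := by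
    have e1 : sk 0 = T' := by simp [hsk]
    have e2 : Mk 0 = M₀ := by simp [hMk]
    simp only [hInv, e1, e2]
    exact hst0
  have hstep : ∀ (k : ℕ) (U : ℝ → UnitAddTorus (Fin 3) → EuclideanSpace ℝ (Fin 3))
      (P : ℝ → UnitAddTorus (Fin 3) → ℝ), Inv k U P →
      ∃ (U' : ℝ → UnitAddTorus (Fin 3) → EuclideanSpace ℝ (Fin 3))
        (P' : ℝ → UnitAddTorus (Fin 3) → ℝ), Inv (k + 1) U' P' ∧
          (∀ t < sk (k + 1) + 1 / 2, U' t = U t) ∧ (∀ t < sk (k + 1) + 1 / 2, P' t = P t) := by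
    intro k U P hI
    simp only [hInv] at hI
    obtain ⟨hsol, hag, hdat, -, hdev, hmz, hpz⟩ := hI
    obtain ⟨U', P', h1, h2, h3, h4, h5, h6, h7, h8, h9⟩ :=
      restart_step hε₀ hτs hT1 hη x₀ (hsk0 k) (hMk_pos k) (hTsk k)
        (hsmall₁ (Mk k) (hMk_pos k).le (hMk_le k)) (hsmall₂ (Mk k) (hMk_pos k).le (hMk_le k))
        hsol hag hdat hdev hmz hpz
    rw [hsk_succ, hMk_succ] at h1 h3 h4 h5 h6
    rw [hsk_succ] at h8 h9
    refine ⟨U', P', ?_, h8, h9⟩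
    simp only [hInv]
    exact ⟨h1, h2, h3, h4, h5, h6, h7⟩
  choose! F G hF using hstep
  -- the sequence of stages
  let seq : ℕ → (ℝ → UnitAddTorus (Fin 3) → EuclideanSpace ℝ (Fin 3)) ×
      (ℝ → UnitAddTorus (Fin 3) → ℝ) :=
    fun k => Nat.rec (U0, P0) (fun k q => (F k q.1 q.2, G k q.1 q.2)) k
  have hseq_succ : ∀ k, seq (k + 1) = (F k (seq k).1 (seq k).2, G k (seq k).1 (seq k).2) :=
    fun k => rfl
  have hI : ∀ k, Inv k (seq k).1 (seq k).2 := by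
    intro k
    induction k with
    | zero => exact hInv0
    | succ k ih =>
        rw [hseq_succ]
        exact (hF k _ _ ih).1
  have hconsU : ∀ k, ∀ t < sk (k + 1) + 1 / 2, (seq (k + 1)).1 t = (seq k).1 t := fun k t ht => by
    rw [hseq_succ]
    exact (hF k _ _ (hI k)).2.1 t ht
  have hconsP : ∀ k, ∀ t < sk (k + 1) + 1 / 2, (seq (k + 1)).2 t = (seq k).2 t := fun k t ht => by
    rw [hseq_succ]
    exact (hF k _ _ (hI k)).2.2 t ht
  have hchain : ∀ k m : ℕ, k ≤ m → ∀ t < sk (k + 1) + 1 / 2,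
      (seq m).1 t = (seq k).1 t ∧ (seq m).2 t = (seq k).2 t := by
    intro k m hkm
    induction m, hkm using Nat.le_induction with
    | base => intro t _; exact ⟨rfl, rfl⟩
    | succ m hkm ih =>
        intro t ht
        have ht' : t < sk (m + 1) + 1 / 2 :=
          ht.trans_le (by linarith [hsk_mono (Nat.succ_le_succ hkm)])
        rw [hconsU m t ht', hconsP m t ht']
        exact ih t ht
  -- the global fields: at time `t` read the stage `N t`, chosen with `t < sk (N t)`
  set N : ℝ → ℕ := fun t => ⌊(t - T') / τs⌋₊ + 1 with hN
  have hNt : ∀ t, t < sk (N t) := by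
    intro t
    have h1 := Nat.lt_floor_add_one ((t - T') / τs)
    rw [div_lt_iff₀ (by linarith)] at h1
    simp only [hsk, hN]
    push_cast
    linarith
  set Ug : ℝ → UnitAddTorus (Fin 3) → EuclideanSpace ℝ (Fin 3) := fun t => (seq (N t)).1 t with hUg
  set Pg : ℝ → UnitAddTorus (Fin 3) → ℝ := fun t => (seq (N t)).2 t with hPg
  have hloc : ∀ (k : ℕ), ∀ t < sk k + 1 / 2, Ug t = (seq k).1 t ∧ Pg t = (seq k).2 t := by
    intro k t ht
    simp only [hUg, hPg]
    rcases le_or_gt k (N t) with hkN | hNk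
    · exact hchain k (N t) hkN t (ht.trans_le (by linarith [hsk_mono (Nat.le_succ k)]))
    · have h1 := hchain (N t) k hNk.le t
        ((hNt t).trans_le (by linarith [hsk_mono (Nat.le_succ (N t))]))
      exact ⟨h1.1.symm, h1.2.symm⟩
  -- classical on `(0, ∞)` by locality
  have hglobal : Torus.IsClassicalNSSolutionOn (Ioi 0) 1 0 Ug Pg := by
    refine Torus.IsClassicalNSSolutionOn.of_local isOpen_Ioi fun t ht => ?_
    have hI' := hI (N t)
    simp only [hInv] at hI'
    obtain ⟨hsol, -⟩ := hI'
    have hw := hwin (N t)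
    refine ⟨Ioo 0 (sk (N t) + 1 / 2), isOpen_Ioo, ⟨ht, (hNt t).trans (by linarith)⟩,
      fun τ hτ => hτ.1, (seq (N t)).1, (seq (N t)).2,
      hsol.mono (Ioo_subset_Ioo_right (by linarith)) isOpen_Ioo.uniqueDiffOn,
      fun τ hτ => ((hloc (N t) τ hτ.2).1).symm, fun τ hτ => ((hloc (N t) τ hτ.2).2).symm⟩
  refine ⟨Ug, Pg, hglobal, fun t ht => ?_, Real.sqrt (T' + τs) * (C₀ * M₀), fun t hTt x => ?_⟩
  · -- agreement with `u` on `(0, T]`: read at stage `1`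
    have h1 : t < sk 1 + 1 / 2 := by
      have := hTsk 0
      rw [hsk_succ] at this
      linarith [ht.2]
    rw [(hloc 1 t h1).1]
    have hI1 := hI 1
    simp only [hInv] at hI1
    exact hI1.2.1 t ht
  · -- the Koch–Tataru bound for `t ≥ T`: on `[sk k, sk (k+1)]` the size is `C₀ M₀ 2^{-k}`
    set k : ℕ := ⌊(t - T') / τs⌋₊ with hkdef
    have hτs0 : 0 < τs := by linarith
    have ht0 : 0 ≤ (t - T') / τs := div_nonneg (by linarith) hτs0.le
    have hk1 : sk k ≤ t := by
      have h1 := Nat.floor_le ht0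
      rw [← hkdef, le_div_iff₀ hτs0] at h1
      simp only [hsk]
      linarith
    have hk2 : t < sk (k + 1) := by
      have h1 := Nat.lt_floor_add_one ((t - T') / τs)
      rw [← hkdef, div_lt_iff₀ hτs0] at h1
      simp only [hsk]
      push_cast
      linarith
    have hUt : Ug t = (seq k).1 t := by
      rw [(hloc (k + 1) t (hk2.trans (by linarith))).1]
      exact hconsU k t (hk2.trans (by linarith))
    have hIk := hI k
    simp only [hInv] at hIk
    obtain ⟨-, -, hdat, hbd, -⟩ := hIk
    have hC₀Mk : 0 ≤ C₀ * Mk k := by have := hMk_pos k; positivity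
    have hnorm : ‖Ug t x‖ ≤ C₀ * Mk k := by
      rw [hUt]
      rcases hk1.eq_or_lt with h | h
      · rw [← h]
        exact (hdat x).trans (le_mul_of_one_le_left (hMk_pos k).le hC₀)
      · refine hbd t ⟨h, hk2.trans_le ?_⟩ x
        rw [← hsk_succ]
        linarith [hwin k]
    have hsqrt : Real.sqrt t ≤ Real.sqrt (T' + τs) * 2 ^ k := by
      have h1 : t ≤ (T' + τs) * ((k : ℝ) + 1) := by
        have hk0 : (0 : ℝ) ≤ k := Nat.cast_nonneg k
        have e : sk (k + 1) = T' + ((k : ℝ) + 1) * τs := by simp only [hsk]; push_cast; ring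
        rw [e] at hk2
        nlinarith
      have h2 : ((k : ℝ) + 1) ≤ 2 ^ k := by exact_mod_cast Nat.lt_two_pow_self
      have h3 : Real.sqrt ((k : ℝ) + 1) ≤ (k : ℝ) + 1 := by
        rw [Real.sqrt_le_left (by positivity)]
        nlinarith
      calc Real.sqrt t ≤ Real.sqrt ((T' + τs) * ((k : ℝ) + 1)) := Real.sqrt_le_sqrt h1
        _ = Real.sqrt (T' + τs) * Real.sqrt ((k : ℝ) + 1) := Real.sqrt_mul (by linarith) _
        _ ≤ Real.sqrt (T' + τs) * ((k : ℝ) + 1) :=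
            mul_le_mul_of_nonneg_left h3 (Real.sqrt_nonneg _)
        _ ≤ Real.sqrt (T' + τs) * 2 ^ k := mul_le_mul_of_nonneg_left h2 (Real.sqrt_nonneg _)
    calc Real.sqrt t * ‖Ug t x‖ ≤ (Real.sqrt (T' + τs) * 2 ^ k) * (C₀ * Mk k) :=
          mul_le_mul hsqrt hnorm (norm_nonneg _) (by positivity)
      _ = Real.sqrt (T' + τs) * (C₀ * M₀) := by
          simp only [hMk]
          field_simp

end Literature.Barriers.NavierStokesRegularity

end
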